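import Summits.NavierStokesRegularity.NavierStokesRegularity.Theses.FilamentSkeletonRss

/-!
# Route FilamentSkeletonRss — `Assembly` (item stmt-NavierStokesRegularity-16007)

`Assembly` is by definition the implication
`SkeletonEquilibrium → CoreGluing → RdssProfileTruncation → ¬ NavierStokesRegularity`,
stated by name over the route's own decls, i.e. literally the type of the route's crux-only deciding
theorem `closes` (D-0027 §2.1, rev 4, rendered at the end of the route file). The proof is that
theorem: the skeleton (K1) and the Burgers-core gluing (K2) give the RSS field `u` of
`RssProfileExists`; at the factor `c = 2` it is rotated-DSS with the isometry `R(−2α log 2)`, its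
slice `u(−1) = U` is continuous and `≠ 0`, so `u` is a witness for the hypothesis of the
conjecture-free rotated truncation bridge `RdssProfileTruncation`, which yields a rapidly decaying
datum whose Leray–Hopf classical solution has finite maximal lifespan `T`; Clay (A) on that datum
plus the PROVED Clay-class uniqueness `Theorems.blowup_clay_uniqueness` (stmt-0153, invoked by name
inside `closes`, not assumed) extend the blowing-up solution past `T` — contradicting maximality.
-/

-- the summit and its single sub-problem share the name (CONVENTIONS §1), as in every Theorems file
set_option linter.dupNamespace false

namespace Summit.NavierStokesRegularity.NavierStokesRegularity.Theorems

open Summit.NavierStokesRegularity.NavierStokesRegularity.Theses.FilamentSkeletonRss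

/-- **Assembly of route `FilamentSkeletonRss`** (item stmt-NavierStokesRegularity-16007):
`SkeletonEquilibrium → CoreGluing → RdssProfileTruncation → ¬ NavierStokesRegularity`.
This is exactly the route's crux-only deciding theorem `Theses.FilamentSkeletonRss.closes`
(pure logic over the three cruxes: the glued RSS field at factor `2` feeds the truncation bridge;
Clay (A) on the resulting datum, the proved Clay-class uniqueness `blowup_clay_uniqueness` on
`[0, T)`, and restriction of the global solution to `[0, T + 1)` contradict maximality). -/
theorem filamentSkeletonRss_assembly_proof :
    Summit.NavierStokesRegularity.NavierStokesRegularity.Theses.FilamentSkeletonRss.Assembly := by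
  unfold Assembly
  -- buildfix 2026-08-19 (proof-only): the route's `closes` was re-cut on 2026-08-17 (rev ≥ 5) to the
  -- finer hypotheses `SelectionBoxR`, `CoreLinearInvertibility`, `CoreGluingGivenInvertibilityQR`,
  -- `BoxSelectionR`, which it only uses to produce `RssProfileExists`; here `CoreGluing` applied to
  -- `SkeletonEquilibrium` gives `RssProfileExists` directly, and the rest is the body of `closes` verbatim.
  intro hS hCG hT
  obtain ⟨α, C₀, U, Rot, u, -, -, hU2, hU0, hu1, hrss, hmild, hmeas, hC⟩ := hCG hS
  -- an RSS field is rotated discretely self-similar for every factor; take c = 2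
  have hrdss : Literature.Analysis.FluidPDE.IsRotatedDSS 2 (Rot (-(α * (2 * Real.log 2)))) u :=
    hrss 2 two_pos
  -- nontriviality on t < 0: the slice at t = -1 is U itself, continuous and ≠ 0
  have hnz : ¬ (∀ t < 0, u t =ᵐ[MeasureTheory.volume] 0) := by
    intro h
    have h1 := h (-1) (by norm_num)
    rw [hu1] at h1
    exact hU0 ((Continuous.ae_eq_iff_eq MeasureTheory.volume hU2.continuous continuous_const).1 h1)
  -- the truncation bridge (hT): a rapidly decaying datum whose Leray–Hopf classical solution `v` has
  -- finite maximal lifespan `T`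
  obtain ⟨ν, hν, T, hT', v, q, ⟨hcl, hmax⟩, hLH, hdec⟩ :=
    hT ⟨2, _, _, one_lt_two, hmild, hmeas, hrdss, ⟨C₀, hC⟩, hnz⟩
  intro hA
  have h0 : (0 : ℝ) ∈ Set.Ico 0 T := ⟨le_rfl, hT'⟩
  -- Clay (A) from that datum: a global class-(A) solution `(u', p')`
  obtain ⟨u', p', hu', hp', hns, hbe⟩ :=
    hA ν hν (v 0) (hcl.contDiff_velocity h0) (hcl.divFree 0 h0) hdec
  -- X5b = stmt-NavierStokesRegularity-0153, PROVED in tree: invoked BY NAME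
  have heq : ∀ t ∈ Set.Ico 0 T, u' t = v t :=
    _root_.Summit.NavierStokesRegularity.NavierStokesRegularity.Theorems.blowup_clay_uniqueness
      ν hν (v 0) hdec u' v p' q T hT' hu' hp' hns hbe hcl hLH rfl
  -- so the blowing-up solution extends classically past its maximal lifespan: contradiction
  have hcl' : Literature.Analysis.FluidPDE.IsClassicalNSSolutionOn (Set.Ici 0) ν 0 u' p' :=
    ⟨hu', hp', fun t ht x => hns.momentum t ht x, fun t ht => hns.divFree t ht⟩
  refine hmax ⟨T + 1, by linarith, u', p', ?_, heq⟩
  exact hcl'.mono (fun t ht => ht.1) (uniqueDiffOn_Ico 0 (T + 1))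

end Summit.NavierStokesRegularity.NavierStokesRegularity.Theorems
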